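import Summits.CriticalPhenomena.PercolationContinuityZ3.Theorems.Transplant.SkelPhiRunKitsF
import HarnessLib

/-!
# N2 (frames-only node `SamePDropOfSkeletonFrm₁`, OPEN), (S0) kit tier, (C)/(R) junction: **THE FORCED KIT CLAUSE OF AN ARBITRARY x-FRAME LEVEL
# FROM A PER-CENTRE "PARKED OR ROUTED" INPUT** (`Skelφ.hkits_levelF`) and **THE ROUTE SETS OF A WINDOW FROM TWO READINGS** (`Skelφ.routeSetsW`) —
# hp-8 g39's `hkits_runXF` (SkelPhiRunKitsF p340375) with the schedule `xRunSched` abstracted to a level box `[lo − j, hi + j]` with enlargement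
# radius `R₀`, and p1-g11's `routeSetsN_x` (SkelPhiParaRouteN) with the two frame readings abstracted to hypotheses; so that EVERY phase of the K-G
# corridor (`kgCorrSched`: widened E-run, across-parking on axis 1, along-parking — SkelPhiParaCorridorKG/KGRead) and the root legs of (R-26)
# feed p1-g16's assembler `kitsAt_stepAFF` through ONE lemma: at a FAR (parking) centre the input is `c ∈ T` (first branch of `kitClauseF`'s
# zone-box disjunction, `c ∈ Λc c kz`), at a striding centre it is the route datum built by `routeSetsW` from the link/landing readings.

builds on p205010 (kernel theorem, internal audit signed; external expert review pending) — nothing in this file uses p205010; nothing here is a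
claim about the open node `SamePDropOfSkeletonFrm₁`.
Lane `prim-bschramm`, seat `prim-bschramm-p5` (gen 15; (C) lineage); helper file (`--supports stmt-CriticalPhenomena-4575 --as helper`).
* §1 **`routeSetsW`**: window `(w₀, R)`, centre `c ∈ B(w₀, R − r)`, `Rl ≤ r ≤ R`, a finite piece `Ft ⊆ pgramPrism c n h (3ℓ) Rl`, readings
  `pgramPrism ↦ Reg`, `Ft ↦ Core′` under `ψ`, `Win Reg ⊆ Dr`, `Win Core′ ⊆ T`, subbox law `Wt` on `Dr`, certificate `1 − δ₂ < P_q(linkIn prism SEED Ft)`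
  ⟹ `∃ Qt Ft′, Ft′ ⊆ T ∧ Qt ⊆ Dr ∧ 1 − δ₂ < P_{Wt}(linkIn Qt SEED Ft′)`;
* §2 **`hkits_levelF`**: `hkits_runXF` with `(xRunSched …).lo k / hi k / R′ ↦ lo / hi / R₀` and the long-link input replaced by
  `hroute : ∀ c, ψ c ∈ [lo − R₀, hi + R₀] → c ∈ B(w₀, R − r) → c ∈ T ∨ ∃ Qt Ft, Ft ⊆ T ∧ Qt ⊆ Dr ∧ 1 − δ³ ≤ P_{Wt}(linkIn Qt (Λc c kz) Ft)`.
[cite: KozmaNitzan2024, §4 Lemma 10, Steps III–IV (pp. 19–21); Lemma 12 (pp. 23–25)] [cite: MartineauTassion2017, §4.3 Lemma 4.2]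
-/

noncomputable section

open scoped Classical

namespace Summit.CriticalPhenomena.PercolationContinuityZ3.Theorems.Transplant

namespace Skelφ

open MeasureTheory
open Literature.Probability.Percolation Literature.Probability.LatticeModels SimpleGraph KNLevels
open Literature.Barriers.CriticalPhenomena (graphBall graphBall_finite mem_graphBall_self graphBall_mono)
open Skel (winGraph winGraph_adj winGraph_le winGraphIn winGraphIn_le KitGeom)
open Literature.Probability.Percolation.KozmaNitzan.Cells (oth oth_ne eq_oth_of_ne oth_oth)
open SkelI (tanOff tanTgt tanTgt_mem)

variable {V : Type} [DecidableEq V] {G : SimpleGraph V} [G.LocallyFinite] {ψ φ : V → Site 2}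

/-! ## §1 The route sets of a window from two readings -/

/-- **THE ROUTE SETS OF A WINDOW FROM TWO READINGS**: `Qt := pgramPrismFin c n h (3ℓ) Rl` (read into `Reg`, whose window lies in `Dr`) and the
given finite piece `Ft ⊆ pgramPrism …` (read into `Core′`, whose window lies in `T`); the certificate under `P_q` transfers to the subbox weighting `Wt`
of the window graph because the event is determined inside `Qt ⊆ Dr ⊆ B(w₀, R)`. [cite: KozmaNitzan2024, §4 Lemma 10 Step IV (pp. 20–21)] -/
theorem routeSetsW [Countable V] {n : ℕ} (h : ℤ) (ℓ : ℕ) {w₀ c : V} {R r Rl : ℕ} (hcw : c ∈ graphBall G w₀ (R - r)) (hr : Rl ≤ r)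
    (hrR : r ≤ R) {Reg Core' : Finset (Site 2)} {Ft : Finset V} (hFt : (↑Ft : Set V) ⊆ pgramPrism G φ c n h (3 * ℓ) Rl)
    (hQreg : ∀ w ∈ pgramPrism G φ c n h (3 * ℓ) Rl, ψ w ∈ Reg) (hFcore : ∀ w ∈ Ft, ψ w ∈ Core')
    {Dr T : Finset V} (hPD : Win G ψ w₀ Reg R ⊆ Dr) (hPT : Win G ψ w₀ Core' R ⊆ T)
    {q : unitInterval} {Wt : Sym2 V → unitInterval} (hWD : IsSubbox (winGraph G w₀ R) Wt q Dr) {SEED : Finset V} {δ₂ : ℝ}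
    (hev : 1 - δ₂ < (bondPercolation G q).real (linkIn (pgramPrism G φ c n h (3 * ℓ) Rl) SEED Ft)) :
    ∃ Qt Ft' : Finset V, Ft' ⊆ T ∧ Qt ⊆ Dr ∧ 1 - δ₂ < (prodBernoulli Wt).real (linkIn (↑Qt : Set V) SEED Ft') := by
  have hQB : ∀ w ∈ pgramPrism G φ c n h (3 * ℓ) Rl, w ∈ graphBall G w₀ R := fun w hw =>
    pgramPrism_subset_graphBall_of_mem hcw hr hrR n h (3 * ℓ) hw
  have hQD : pgramPrismFin G φ c n h (3 * ℓ) Rl ⊆ Dr := fun w hw => by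
    have hw' := (mem_pgramPrismFin G φ).1 hw
    exact hPD ((mem_Win G _).2 ⟨hQB w hw', hQreg w hw'⟩)
  refine ⟨pgramPrismFin G φ c n h (3 * ℓ) Rl, Ft, fun w hw => ?_, hQD, ?_⟩
  · exact hPT ((mem_Win G _).2 ⟨hQB w (hFt (Finset.mem_coe.2 hw)), hFcore w hw⟩)
  · have hcoe : (↑(pgramPrismFin G φ c n h (3 * ℓ) Rl) : Set V) = pgramPrism G φ c n h (3 * ℓ) Rl := by
      ext w; simp
    have heq := Skel.real_eq_of_isSubbox_of_le (winGraph_le G w₀ R) hWD hQD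
      (Skel.adj_winGraph_of_subset_graphBall fun v hv => hQB v ((mem_pgramPrismFin G φ).1 hv))
      (determinedBy_linkIn (↑(pgramPrismFin G φ c n h (3 * ℓ) Rl)) SEED Ft subset_rfl)
      (measurableSet_linkIn _ _ _)
    rw [heq, hcoe]
    exact hev

/-! ## §2 The forced kit clause of an arbitrary x-frame level -/

/-- **THE FORCED KIT CLAUSE OF AN x-FRAME LEVEL FROM A PER-CENTRE PARKED-OR-ROUTED INPUT** (`hkits` of `kitsAt_stepAFF`): window `runX φ c₀ n_L h_L σ`
around `w₀` (radius `R`), level box `[lo − j, hi + j]`, enlargement radius `R₀ ≥ j + reach`, region `Dr ⊇` the level, target `T ⊇` the far part of the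
level; kit constants, short region and zone datum as in `hkits_runXF`; at every kit centre `c` with `ψ c ∈ [lo − R₀, hi + R₀]`, `c ∈ B(w₀, R − r)`:
EITHER `c ∈ T` (the centre is parked) OR a route datum at accuracy `δ³`. [cite: KozmaNitzan2024, §4 Lemma 10 (pp. 17–21), Lemma 12] [this work] -/
theorem hkits_levelF [Countable V] (hlipφ : Lip G φ) (hstep : Steps G φ) {Δ : ℕ} (hΔ : ∀ v, G.degree v ≤ Δ) {q : unitInterval} {δ : ℝ} (hδ : 0 < δ)
    -- the frame and the level box
    {nL : ℕ} (hnL : 1 ≤ nL) (c₀ : V) (hL : ℤ) {σ : ℤ} (hσ : σ = 1 ∨ σ = -1) {kq : ℕ} (hκL : hL.natAbs ≤ kq * nL)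
    {lo hi : Site 2} {R₀ : ℕ} {j : ℕ} {w₀ : V} {R r : ℕ}
    -- kit constants
    (P : ApronPrm) {Mz Rs KCmax rs cS cU : ℕ} (hPN : kq + 3 ≤ P.N) (hA : P.A = (Mz + 1 : ℕ) * (shearUnit nL hL : ℤ) + 1)
    (hdD : P.d + 2 ≤ shellD P) (hDρ : Rs + 1 ≤ shellD P) (hKCmax : (shellD P + Mz + 1) * (kq + 1) ≤ KCmax)
    (hwide : ∀ i, (lo - (j : Site 2)) i + 2 * tanOff P.ℓs P.M ≤ (hi + (j : Site 2)) i)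
    (hdw : ∀ i, (lo - (j : Site 2)) i + (P.d + 2 : ℕ) ≤ (hi + (j : Site 2)) i)
    (hDw : ∀ i, (lo - (j : Site 2)) i + ((shellD P + 1 + P.d + KCmax + Rs : ℕ) : ℤ) ≤
      (hi + (j : Site 2)) i)
    (hT : (shellD P : ℤ) + KCmax + Rs ≤ tanOff P.ℓs P.M)
    (hr₀ : P.N * (tanOff P.ℓs P.M + 2) + P.N * P.d + (KCmax + Rs) ≤ P.r₀) (hR : P.r₀ ≤ R)
    (hrs : 1 + (P.N * (tanOff P.ℓs P.M + 2) + P.N * P.d + (KCmax + Rs)) ≤ rs)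
    (hcS : (P.N + 1) * (tanOff P.ℓs P.M + 1) + (P.N + 1) * P.d + (KCmax + 1) + cU ≤ cS)
    -- the reach of the kit centre: inside the `R′`-enlargement, and `B(w₀, R − r)` with `Rl ≤ r ≤ R`
    (hE : j + (P.N * (tanOff P.ℓs P.M + 1) + P.N * P.d + KCmax) ≤ R₀)
    (hreach : r + (P.N * (tanOff P.ℓs P.M + 1) + P.N * P.d + KCmax) ≤ P.r₀)
    -- the short region and the zone datum at the kit centres (inside `Rg`, connected from the centre inside itself, containing the centre
    -- and the fat-prism zone box of record `cylBallFin c kz Rk`, `Rk ≥ cylRadMax types kz (2·KCmax)` — whence the forced column's end)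
    (Rg : V → Finset V) (hRg : ∀ c, ∀ u ∈ Rg c, u ∈ graphBall G c Rs) (hRgcard : ∀ c, (Rg c).card ≤ cU) (hcU1 : 1 ≤ cU)
    (Λc : V → ℕ → Finset V) (kz : ℕ) (hΛRg : ∀ c, Λc c kz ⊆ Rg c) (hzconn : ∀ c, ∀ s ∈ Λc c kz, PathIn G (↑(Λc c kz) : Set V) c s)
    (hcz : ∀ c, c ∈ Λc c kz)
    {types : Finset V} (hfr : Frames G φ types) (hκ : CylConn G φ types) {Rk : ℕ} (hkz : 1 ≤ kz)
    (hRk : cylRadMax G φ types kz (2 * KCmax) ≤ Rk) (hΛcyl : ∀ c, cylBallFin G φ c kz Rk ⊆ Λc c kz)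
    -- the level's source/support, the weighting on the region, the target
    (kk : ℕ) (o : V) (Sfin : Finset V) {Wt : Sym2 V → unitInterval} {Dr T : Finset V}
    (hXD : winLevel G (runX φ c₀ nL hL σ) w₀ R (lo) (hi) j ⊆ Dr)
    (hfarT : ∀ v ∈ winLevel G (runX φ c₀ nL hL σ) w₀ R (lo) (hi) j,
      v ∉ graphBall G w₀ (R - P.r₀) → v ∈ T)
    {N : ℕ} (hN : kk * (Δ + 1) ^ (2 * rs) ≤ N) (hk : (1 - (q : ℝ) ^ (1 + Δ * cS + cS * cU)) ^ kk ≤ δ)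
    -- THE INPUT AT EVERY CENTRE: the centre is PARKED (already in the target) or carries a route datum at accuracy `δ³`
    (hroute : ∀ c : V, runX φ c₀ nL hL σ c ∈ Finset.Icc (lo - ((R₀ : ℕ) : Site 2)) (hi + ((R₀ : ℕ) : Site 2)) → c ∈ graphBall G w₀ (R - r) →
      c ∈ T ∨ ∃ Qt Ft : Finset V, Ft ⊆ T ∧ Qt ⊆ Dr ∧ 1 - δ ^ 3 ≤ (prodBernoulli Wt).real (linkIn (↑Qt : Set V) (Λc c kz) Ft)) :
    ∃ (σ' : SData V) (S : Finset V),
      SHyp (winLData G (runX φ c₀ nL hL σ) w₀ R (lo) (hi) o Sfin) j σ' ∧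
      σ'.N ≤ N ∧ (1 - (q : ℝ) ^ σ'.sB) ^ σ'.k ≤ δ ∧ S ⊆ Dr ∧ (∀ x ∈ σ'.K, σ'.face x ⊆ S) ∧
      RelayClause (winLData G (runX φ c₀ nL hL σ) w₀ R (lo) (hi) o Sfin) Wt j σ' S T Dr δ := by
  set ψ := runX φ c₀ nL hL σ with hψ
  set SF := runXSideU (φ := φ) c₀ hnL hL hσ (lo - (j : Site 2)) (hi + (j : Site 2)) with hSF
  have hKeq : winLevel G ψ w₀ R (lo) (hi) j = Win G ψ w₀ (Finset.Icc (lo - (j : Site 2)) (hi + (j : Site 2))) R := rfl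
  -- the frame facts used for the reach
  have hlip : Lip G ψ := lip_runX hlipφ hσ hnL c₀ hL
  have hq : QStepsN G ψ P.N := (qStepsN_runX hstep hnL c₀ hL hσ hκL).mono hPN
  have hU1 : (1 : ℤ) ≤ (shearUnit nL hL : ℤ) := by have := shearUnit_pos hnL hL; omega
  have hU : (shearUnit nL hL : ℤ) ≤ ((kq + 1 : ℕ) : ℤ) * nL := by
    have : ((shearUnit nL hL : ℕ) : ℤ) = nL + (hL.natAbs : ℤ) := by unfold shearUnit; push_cast; ring
    rw [this]; push_cast
    have : (hL.natAbs : ℤ) ≤ kq * nL := by exact_mod_cast hκL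
    linarith
  have haff : ∀ (i : Fin 2) (σ₀ : ℤˣ), (SF i σ₀).IsAffine (shearUnit nL hL : ℤ) (if i = 0 then (shearUnit nL hL : ℤ) else nL) := fun i σ₀ => by
    rw [hSF]; exact runXSideU_isAffine c₀ hnL hL hσ _ _ i σ₀
  have hC : ∀ (i : Fin 2) (σ₀ : ℤˣ), (nL : ℤ) ≤ (if i = 0 then (shearUnit nL hL : ℤ) else nL) := fun i σ₀ => by
    split_ifs
    · have : ((shearUnit nL hL : ℕ) : ℤ) = nL + (hL.natAbs : ℤ) := by unfold shearUnit; push_cast; ring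
      rw [this]; linarith [Int.natCast_nonneg hL.natAbs]
    · exact le_rfl
  have hKC := hKC_of_affine SF haff hU1 P hnL hC hU hA hKCmax
  -- the column row for the fat-prism zone box (p1-g16's `ctColEnd_mem_cylBallFin`)
  have hw2 : ∀ i, (lo - (j : Site 2)) i + 2 ≤ (hi + (j : Site 2)) i := fun i => by
    have h := hdw i; push_cast at h; linarith [Nat.cast_nonneg (α := ℤ) P.d]
  have hcol := fun x (hx : x ∈ outerBoundary (winGraph G w₀ R) (Win G ψ w₀ (Finset.Icc (lo - (j : Site 2)) (hi + (j : Site 2))) R))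
      (_ : IsNear G ψ (lo - (j : Site 2)) (hi + (j : Site 2)) P w₀ R x) =>
    hΛcyl _ (ctColEnd_mem_cylBallFin SF hlip hq hstep hfr hκ hw2 (fun i σ₀ z h1 _ => hKC i σ₀ z h1) hkz hRk hx)
  refine kitClause_runXF hlipφ hstep hΔ hδ hnL c₀ hL hσ hκL P hPN hA hdD hDρ hKCmax hwide hdw hDw hT hr₀ hR hrs hcS Rg hRg hRgcard
    hcU1 Λc kz hΛRg hzconn hcz hcol kk o Sfin hXD hN hk (fun x hx hfar => ?_) (fun x hx hnear => ?_)
  · -- FAR: the inner neighbour lies in the level and outside `B(w₀, R − r₀)`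
    refine hfarT _ ?_ hfar
    have h := inNbr_spec (G := G) (φ := ψ) (by rw [hKeq] at hx; exact hx)
    rw [hKeq]
    exact (mem_Win G ψ).2 ⟨h.2.1, h.2.2⟩
  · -- NEAR: the kit centre is parked (first branch of the zone-box disjunction) or carries the route datum (second branch)
    have hx' : x ∈ outerBoundary (winGraph G w₀ R) (Win G ψ w₀ (Finset.Icc (lo - (j : Site 2)) (hi + (j : Site 2))) R) := by
      rw [hKeq] at hx; exact hx
    set c := ctCtr G SF P w₀ R x with hc
    have hcI : ψ c ∈ Finset.Icc (lo - ((R₀ : ℕ) : Site 2)) (hi + ((R₀ : ℕ) : Site 2)) :=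
      ψ_ctCtr_mem_Icc SF hlip hq hstep hwide (fun i σ₀ z h1 h2 => hKC i σ₀ z h1) hE hx
    have hcw : c ∈ graphBall G w₀ (R - r) := by
      have hd := ctCtr_reach SF hlip hq hstep hwide (fun i σ₀ z h1 h2 => hKC i σ₀ z h1) hx'
      have h := BoxProdZ2.mem_graphBall_add G hnear hd
      exact graphBall_mono G _ (by omega) h
    rcases hroute c hcI hcw with hcT | ⟨Qt, Ft, hFT, hQD, hle⟩
    · exact Or.inl ⟨c, hcz c, hcT⟩
    · exact Or.inr ⟨Qt, Ft, hFT, hQD, hle⟩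

end Skelφ

end Summit.CriticalPhenomena.PercolationContinuityZ3.Theorems.Transplant

end
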